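import Mathlib
import HarnessLib
import Summits.Ventures.LatticeQCDFlow.Scoring.IMHAcceptanceFromWeights
import Summits.Ventures.LatticeQCDFlow.Scaling.AcceptanceEssEightNinths

/-!
# LatticeQCDFlow / Scaling — the JENSEN FLOOR of the acceptance from the training monitors:
# `acc ≥ exp(−D(q‖p) − ½·E_{q⊗q}|log w − log w′|) ≥ exp(−D(q‖p) − σ_q(log w)/√3)`

HONEST FRAMING: exact (Metropolis-corrected) sampling algorithms for lattice gauge theory;
figures of merit are autocorrelation/cost numbers at stated couplings and volumes; no
continuum-physics claim.

Venture `LatticeQCDFlow` (cell pub-lqcd), topic `Scaling`; FANOUT row 3 (`s0-u1-a`, S0-B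
implementation A — deliverable 'training curves', GEN-11).  NEW WORK of the cell (one application of
Jensen's inequality), not a published result; NO definition is introduced.  Vocabulary: `accRate`
(row 30's `Exactness/FlowMCMC`), `weight`, `klFin` (row 31's `Scaling/ImportanceWeights`),
`accRate_eq_qq_min_weight` (row 11's `Scoring/IMHAcceptanceFromWeights`), `accRate_pos_of_normalised`
(row 3's `Scaling/AcceptanceEssEightNinths`); finite configuration spaces, target `p > 0` and model
`q > 0` normalised (all importance weights `w = p/q` positive, so `ℓ = log w` is defined).

A flow trainer watches two numbers per checkpoint: the REVERSE Kullback–Leibler loss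
`D(q‖p) = −E_q[log w]` (up to the unknown `log Z`) and the spread of the log-weights under the
model, `Var_q(log w)`.  The tree's floors on the equilibrium acceptance `acc` of the exact chain from
these monitors are Pinsker's `acc ≥ 1 − √(2·D(q‖p))` (row 3's `Scaling/AcceptancePinskerFloor`,
VACUOUS once `D ≥ 1/2` nat) and the sup-oscillation floor `acc ≥ e^{−K}` (theory-1's
`Scaling/AcceptanceFloor`, `K = max log w − min log w`).  Because
`acc = E_{q⊗q} min(w, w′)` is the mean of a POSITIVE quantity over the model pair law, Jensen's
inequality for the logarithm gives a floor that is NEVER vacuous and uses only AVERAGED quantities: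

* `log_min_eq_half` — `log min(u, v) = (log u + log v)/2 − |log u − log v|/2` (`u, v > 0`);
* **`sum_log_weight_sub_half_mad_le_log_accRate`** — THE JENSEN FLOOR
  `E_q[log w] − ½·E_{q⊗q}|log w − log w′| ≤ log acc(p, q)`;
* `sum_mul_log_weight_eq_neg_klFin` — `E_q[log w] = −D(q‖p)`; hence
  **`exp_neg_klFin_sub_half_mad_le_accRate`** — `acc ≥ exp(−D(q‖p) − ½·E_{q⊗q}|log w − log w′|)`;
* `sq_qq_abs_sub_le_four_thirds_var` — Glasser for ANY observable `g` under `q`: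
  `(E_{q⊗q}|g − g′|)² ≤ (4/3)·Var_q(g)` (mid-rank representation, row 3's
  `Scaling/AcceptanceGiniFloorSharp`), `half_qq_abs_sub_le_sqrt_third_var` (`½E|g − g′| ≤ σ/√3`), so
  **`exp_neg_klFin_sub_sqrt_third_var_le_accRate`** — `acc ≥ exp(−D(q‖p) − σ_q(log w)/√3)`: the
  acceptance of the exact chain is bounded below by the exponential of minus (training loss + `1/√3`
  standard deviations of the log-weight); (this bullet CORRECTED at the GEN-11 append: the landed
  text named a `√(Var/2)` form that the file never contained — the theorems are the sharper `1/√3`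
  ones);
* `accRate_jensenFloor_self` — the floor is an equality for the perfect flow `p = q` (both sides `1`).
* (appended, GEN-11) `exp_neg_klFin_fwd_sub_half_mad_le_accRate`,
  `exp_neg_klFin_fwd_sub_sqrt_third_var_le_accRate` — the TARGET-SIDE twins
  `acc ≥ exp(−D(p‖q) − ½·E_{p⊗p}|log w − log w′|) ≥ exp(−D(p‖q) − σ_p(log w)/√3)` (the reversed pair
  `(q, p)` has weight `1/w` and the same acceptance); `exp_neg_min_jensen_le_accRate` — both at once.

Orientation (no number of ours): in the log-normal dictionary of row 11's
`Scoring/IMHLogNormalAcceptance` (`log w ∼ N(−s/2, s)` under `q`, `acc = erfc(√s/2)`) one has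
`D(q‖p) = s/2` and `½·E|ℓ − ℓ′| = √(s/π)`, so the Jensen floor reads `exp(−s/2 − √(s/π))`, which
agrees with `erfc(√s/2) = 1 − √(s/π) + O(s)` to first order as `s → 0` and stays below it for all
`s` (as it must).  NOT CLAIMED: any ceiling on `acc` from these two monitors (none exists: row 3's
`Scaling/AcceptanceEssNoCeiling`); anything about `τ_int`; any acceptance of ours; nothing re-scored.
-/

namespace Summit.Ventures.LatticeQCDFlow.Theory2

open Finset
open Summit.Ventures.LatticeQCDFlow.Exactness
open Summit.Ventures.LatticeQCDFlow.Scoring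

variable {X : Type*} [Fintype X]

/-! ### Pointwise pieces -/

omit [Fintype X] in
/-- `log min(u, v) = (log u + log v)/2 − |log u − log v|/2` for `u, v > 0`. [folklore] -/
theorem log_min_eq_half {u v : ℝ} (hu : 0 < u) (hv : 0 < v) :
    Real.log (min u v) = (Real.log u + Real.log v) / 2 - |Real.log u - Real.log v| / 2 := by
  rcases le_total u v with huv | hvu
  · rw [min_eq_left huv, abs_of_nonpos (sub_nonpos.mpr (Real.log_le_log hu huv))]
    ring
  · rw [min_eq_right hvu, abs_of_nonneg (sub_nonneg.mpr (Real.log_le_log hv hvu))]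
    ring

/-- `E_q[log w] = −D(q‖p)`: for positive `p`, `q`, `Σ_x q_x log(p_x/q_x) = −Σ_x q_x log(q_x/p_x)`.
[folklore] -/
theorem sum_mul_log_weight_eq_neg_klFin {p q : X → ℝ} (hp : ∀ x, 0 < p x) (hq : ∀ x, 0 < q x) :
    ∑ x, q x * Real.log (weight p q x) = -klFin q p := by
  rw [klFin, ← sum_neg_distrib]
  refine sum_congr rfl fun x _ => ?_
  rw [weight, Real.log_div (hp x).ne' (hq x).ne', Real.log_div (hq x).ne' (hp x).ne']
  ring

/-! ### The Jensen floor -/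

/-- **THE JENSEN FLOOR.**  For positive `p` and a positive normalised model `q` on a finite space,
with `w = p/q` and `ℓ = log w`: `E_q[ℓ] − ½·E_{q⊗q}|ℓ − ℓ′| ≤ log acc(p, q)` — Jensen's inequality
for the concave `log` applied to `acc = E_{q⊗q} min(w, w′)`, then
`log min(w, w′) = (ℓ + ℓ′)/2 − |ℓ − ℓ′|/2`.  (The normalisation of `p` is not used.) [ours] -/
theorem sum_log_weight_sub_half_mad_le_log_accRate {p q : X → ℝ} (hp : ∀ x, 0 < p x)
    (hq : ∀ x, 0 < q x) (hq1 : ∑ x, q x = 1) :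
    (∑ x, q x * Real.log (weight p q x))
        - (∑ x, ∑ y, q x * q y * |Real.log (weight p q x) - Real.log (weight p q y)|) / 2
      ≤ Real.log (accRate p q) := by
  classical
  have hw : ∀ z, 0 < weight p q z := fun z => div_pos (hp z) (hq z)
  -- Jensen for `log` on `(0, ∞)` with the pair weights `q ⊗ q`
  have hJ := (strictConcaveOn_log_Ioi.concaveOn).le_map_sum (t := (univ : Finset (X × X)))
    (w := fun z => q z.1 * q z.2) (p := fun z => min (weight p q z.1) (weight p q z.2))
    (fun z _ => mul_nonneg (hq z.1).le (hq z.2).le)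
    (by rw [Fintype.sum_prod_type]; simp_rw [← mul_sum, hq1, mul_one, hq1])
    (fun z _ => Set.mem_Ioi.mpr (lt_min (hw z.1) (hw z.2)))
  simp only [smul_eq_mul] at hJ
  -- the right side is `log acc`
  have hR : ∑ z : X × X, q z.1 * q z.2 * min (weight p q z.1) (weight p q z.2) = accRate p q := by
    rw [accRate_eq_qq_min_weight hq, Fintype.sum_prod_type]
  -- the left side is `E_q ℓ − ½ E|ℓ − ℓ′|`
  have hL : ∑ z : X × X, q z.1 * q z.2 * Real.log (min (weight p q z.1) (weight p q z.2))
      = (∑ x, q x * Real.log (weight p q x))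
        - (∑ x, ∑ y, q x * q y * |Real.log (weight p q x) - Real.log (weight p q y)|) / 2 := by
    have e : ∀ z : X × X, q z.1 * q z.2 * Real.log (min (weight p q z.1) (weight p q z.2))
        = (q z.1 * q z.2 * Real.log (weight p q z.1)) / 2
          + (q z.1 * q z.2 * Real.log (weight p q z.2)) / 2
          - (q z.1 * q z.2 * |Real.log (weight p q z.1) - Real.log (weight p q z.2)|) / 2 := by
      intro z
      rw [log_min_eq_half (hw _) (hw _)]
      ring
    simp_rw [e]
    rw [sum_sub_distrib, sum_add_distrib, ← sum_div, ← sum_div, ← sum_div]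
    have S1 : ∑ z : X × X, q z.1 * q z.2 * Real.log (weight p q z.1)
        = ∑ x, q x * Real.log (weight p q x) := by
      rw [Fintype.sum_prod_type]
      refine sum_congr rfl fun x _ => ?_
      dsimp only
      rw [show ∑ y, q x * q y * Real.log (weight p q x) = q x * Real.log (weight p q x) * ∑ y, q y by
        rw [mul_sum]; exact sum_congr rfl fun y _ => by ring, hq1, mul_one]
    have S2 : ∑ z : X × X, q z.1 * q z.2 * Real.log (weight p q z.2)
        = ∑ y, q y * Real.log (weight p q y) := by
      rw [Fintype.sum_prod_type_right]
      refine sum_congr rfl fun y _ => ?_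
      dsimp only
      rw [show ∑ x, q x * q y * Real.log (weight p q y) = q y * Real.log (weight p q y) * ∑ x, q x by
        rw [mul_sum]; exact sum_congr rfl fun x _ => by ring, hq1, mul_one]
    have S3 : ∑ z : X × X, q z.1 * q z.2 * |Real.log (weight p q z.1) - Real.log (weight p q z.2)|
        = ∑ x, ∑ y, q x * q y * |Real.log (weight p q x) - Real.log (weight p q y)| := by
      rw [Fintype.sum_prod_type]
    rw [S1, S2, S3]
    ring
  rw [hR, hL] at hJ
  exact hJ


/-- **Exponential form**: `exp(E_q[log w] − ½·E_{q⊗q}|log w − log w′|) ≤ acc(p, q)` for positive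
normalised `p`, `q`. [ours] -/
theorem exp_sum_log_weight_sub_half_mad_le_accRate {p q : X → ℝ} (hp : ∀ x, 0 < p x)
    (hq : ∀ x, 0 < q x) (hp1 : ∑ x, p x = 1) (hq1 : ∑ x, q x = 1) :
    Real.exp ((∑ x, q x * Real.log (weight p q x))
        - (∑ x, ∑ y, q x * q y * |Real.log (weight p q x) - Real.log (weight p q y)|) / 2)
      ≤ accRate p q :=
  (Real.le_log_iff_exp_le (accRate_pos_of_normalised (fun x => (hp x).le) hq hp1)).mp
    (sum_log_weight_sub_half_mad_le_log_accRate hp hq hq1)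

/-- **The floor from the two training monitors, I**:
`acc(p, q) ≥ exp(−D(q‖p) − ½·E_{q⊗q}|log w − log w′|)` — reverse KL (the trained loss) plus half
the Gini mean difference of the log-weights under the model. [ours] -/
theorem exp_neg_klFin_sub_half_mad_le_accRate {p q : X → ℝ} (hp : ∀ x, 0 < p x)
    (hq : ∀ x, 0 < q x) (hp1 : ∑ x, p x = 1) (hq1 : ∑ x, q x = 1) :
    Real.exp (-klFin q p
        - (∑ x, ∑ y, q x * q y * |Real.log (weight p q x) - Real.log (weight p q y)|) / 2)
      ≤ accRate p q := by
  rw [← sum_mul_log_weight_eq_neg_klFin hp hq]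
  exact exp_sum_log_weight_sub_half_mad_le_accRate hp hq hp1 hq1

/-! ### From the mean difference to the standard deviation: Glasser's `2/√3` -/

/-- **Gini mean difference ≤ `2/√3` standard deviations, for ANY observable** `g` under a
probability vector `q ≥ 0`: `(Σ_xΣ_y q_x q_y |g_x − g_y|)² ≤ (4/3)·(Σ_x q_x g_x² − (Σ_x q_x g_x)²)` —
the mid-rank representation `E|g − g′| = 2·E[(g − E g)·r]` (row 3's
`qq_abs_sub_eq_two_sum_midrank`, `sum_midrank_eq_zero`), Cauchy–Schwarz, and `E r² ≤ 1/3`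
(`sum_midrank_sq_le_third`).  Row 3's `sq_qq_abs_weight_le_sharp` is the case `g = w`. [ours] -/
theorem sq_qq_abs_sub_le_four_thirds_var {q : X → ℝ} (g : X → ℝ) (hq : ∀ x, 0 ≤ q x)
    (hq1 : ∑ x, q x = 1) :
    (∑ x, ∑ y, q x * q y * |g x - g y|) ^ 2
      ≤ 4 / 3 * (∑ x, q x * g x ^ 2 - (∑ x, q x * g x) ^ 2) := by
  set r : X → ℝ := fun x => ∑ y, q y * Real.sign (g x - g y) with hr
  set m : ℝ := ∑ x, q x * g x with hm
  have hΔ : ∑ x, ∑ y, q x * q y * |g x - g y| = 2 * ∑ x, q x * g x * r x :=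
    qq_abs_sub_eq_two_sum_midrank q g
  have hr0 : ∑ x, q x * r x = 0 := sum_midrank_eq_zero q g
  have hcentre : ∑ x, q x * g x * r x = ∑ x, q x * (g x - m) * r x := by
    have h : ∑ x, q x * (g x - m) * r x = ∑ x, q x * g x * r x - m * ∑ x, q x * r x := by
      rw [mul_sum, ← sum_sub_distrib]
      exact sum_congr rfl fun x _ => by ring
    rw [h, hr0, mul_zero, sub_zero]
  have hvar : ∑ x, q x * (g x - m) ^ 2 = ∑ x, q x * g x ^ 2 - m ^ 2 := by
    have h : ∀ x, q x * (g x - m) ^ 2 = q x * g x ^ 2 - 2 * m * (q x * g x) + m ^ 2 * q x :=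
      fun x => by ring
    simp_rw [h]
    rw [sum_add_distrib, sum_sub_distrib, ← mul_sum, ← mul_sum, ← hm, hq1]
    ring
  have hCS : (∑ x, q x * (g x - m) * r x) ^ 2
      ≤ (∑ x, q x * (g x - m) ^ 2) * ∑ x, q x * r x ^ 2 := by
    have h := Finset.sum_mul_sq_le_sq_mul_sq (Finset.univ : Finset X)
      (fun x => Real.sqrt (q x) * (g x - m)) (fun x => Real.sqrt (q x) * r x)
    have e1 : ∀ x, Real.sqrt (q x) * (g x - m) * (Real.sqrt (q x) * r x)
        = q x * (g x - m) * r x := fun x => by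
      have hs : Real.sqrt (q x) * Real.sqrt (q x) = q x := Real.mul_self_sqrt (hq x)
      calc Real.sqrt (q x) * (g x - m) * (Real.sqrt (q x) * r x)
          = Real.sqrt (q x) * Real.sqrt (q x) * (g x - m) * r x := by ring
        _ = q x * (g x - m) * r x := by rw [hs]
    have e2 : ∀ x, (Real.sqrt (q x) * (g x - m)) ^ 2 = q x * (g x - m) ^ 2 :=
      fun x => by rw [mul_pow, Real.sq_sqrt (hq x)]
    have e3 : ∀ x, (Real.sqrt (q x) * r x) ^ 2 = q x * r x ^ 2 :=
      fun x => by rw [mul_pow, Real.sq_sqrt (hq x)]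
    simp_rw [e1, e2, e3] at h
    exact h
  have hthird : ∑ x, q x * r x ^ 2 ≤ 1 / 3 := sum_midrank_sq_le_third g hq hq1
  have hvar0 : 0 ≤ ∑ x, q x * (g x - m) ^ 2 := sum_nonneg fun x _ => mul_nonneg (hq x) (sq_nonneg _)
  rw [hΔ, hcentre, ← hvar]
  nlinarith [hCS, hthird, hvar0, sq_nonneg (∑ x, q x * (g x - m) * r x),
    mul_le_mul_of_nonneg_left hthird hvar0]

/-- Consequently `½·Σ_xΣ_y q_x q_y |g_x − g_y| ≤ √((Σ q g² − (Σ q g)²)/3)`: half the Gini mean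
difference is at most `1/√3` standard deviations. [ours] -/
theorem half_qq_abs_sub_le_sqrt_third_var {q : X → ℝ} (g : X → ℝ) (hq : ∀ x, 0 ≤ q x)
    (hq1 : ∑ x, q x = 1) :
    (∑ x, ∑ y, q x * q y * |g x - g y|) / 2
      ≤ Real.sqrt ((∑ x, q x * g x ^ 2 - (∑ x, q x * g x) ^ 2) / 3) := by
  have h := sq_qq_abs_sub_le_four_thirds_var g hq hq1
  refine Real.le_sqrt_of_sq_le ?_
  have e : ((∑ x, ∑ y, q x * q y * |g x - g y|) / 2) ^ 2
      = (∑ x, ∑ y, q x * q y * |g x - g y|) ^ 2 / 4 := by ring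
  rw [e]
  linarith

/-- **The floor from the two training monitors, II (standard-deviation form)**:
`acc(p, q) ≥ exp(−D(q‖p) − σ_q(log w)/√3)`, `σ_q(log w)² = E_q[(log w)²] − (E_q log w)²`: the
equilibrium acceptance of the exact chain is at least the exponential of minus (reverse-KL training
loss + `1/√3` standard deviations of the log-weight under the model).  Never vacuous. [ours] -/
theorem exp_neg_klFin_sub_sqrt_third_var_le_accRate {p q : X → ℝ} (hp : ∀ x, 0 < p x)
    (hq : ∀ x, 0 < q x) (hp1 : ∑ x, p x = 1) (hq1 : ∑ x, q x = 1) :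
    Real.exp (-klFin q p - Real.sqrt ((∑ x, q x * Real.log (weight p q x) ^ 2
        - (∑ x, q x * Real.log (weight p q x)) ^ 2) / 3))
      ≤ accRate p q := by
  refine le_trans (Real.exp_le_exp.mpr ?_) (exp_neg_klFin_sub_half_mad_le_accRate hp hq hp1 hq1)
  have h := half_qq_abs_sub_le_sqrt_third_var (fun x => Real.log (weight p q x))
    (fun x => (hq x).le) hq1
  linarith

/-! ### The perfect flow: the floor is attained -/

/-- **Equality for the perfect flow**: if `p = q` (all weights `1`, `D = 0`, no spread) the Jensen
floor `exp(−D(q‖p) − ½·E|log w − log w′|)` equals `1 = acc(p, p)`. [ours] -/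
theorem accRate_jensenFloor_self {p : X → ℝ} (hp : ∀ x, 0 < p x) (hp1 : ∑ x, p x = 1) :
    Real.exp (-klFin p p
        - (∑ x, ∑ y, p x * p y * |Real.log (weight p p x) - Real.log (weight p p y)|) / 2)
      = accRate p p := by
  have hw : ∀ x, weight p p x = 1 := fun x => div_self (hp x).ne'
  have hkl : klFin p p = 0 := by
    rw [klFin]
    exact sum_eq_zero fun x _ => by rw [div_self (hp x).ne', Real.log_one, mul_zero]
  have hacc : accRate p p = 1 := by
    unfold accRate
    simp_rw [mul_comm (p _) (p _), min_self]
    rw [← sum_mul_sum, hp1, mul_one]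
  simp_rw [hw, Real.log_one, sub_self, abs_zero, mul_zero, sum_const_zero, zero_div, hkl,
    neg_zero, sub_zero, Real.exp_zero, hacc]


/-! ### Appended (GEN-11): the FORWARD twin — Jensen under the target pair law `p ⊗ p` -/

/-- **The floor from the TARGET side**: `acc(p, q) ≥ exp(−D(p‖q) − ½·E_{p⊗p}|log w − log w′|)` —
the Jensen floor of the reversed pair `(q, p)` (whose weight is `1/w` and whose acceptance is the
same number, `acc(q, p) = acc(p, q)`), i.e. Jensen under `p ⊗ p` for
`acc = E_{p⊗p} min(1/w, 1/w′)`.  Uses the forward KL `D(p‖q) = E_p[log w]` and the spread of the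
log-weight under the TARGET (the quantities a validated chain estimates). [ours] -/
theorem exp_neg_klFin_fwd_sub_half_mad_le_accRate {p q : X → ℝ} (hp : ∀ x, 0 < p x)
    (hq : ∀ x, 0 < q x) (hp1 : ∑ x, p x = 1) (hq1 : ∑ x, q x = 1) :
    Real.exp (-klFin p q
        - (∑ x, ∑ y, p x * p y * |Real.log (weight p q x) - Real.log (weight p q y)|) / 2)
      ≤ accRate p q := by
  have hsymm : accRate q p = accRate p q := by
    unfold accRate
    refine sum_congr rfl fun x _ => sum_congr rfl fun y _ => ?_
    rw [min_comm, mul_comm (q y) (p x), mul_comm (q x) (p y)]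
  have hlog : ∀ x, Real.log (weight q p x) = -Real.log (weight p q x) := fun x => by
    rw [weight, weight, Real.log_div (hq x).ne' (hp x).ne', Real.log_div (hp x).ne' (hq x).ne']
    ring
  have h := exp_neg_klFin_sub_half_mad_le_accRate hq hp hq1 hp1
  simp_rw [hlog, hsymm] at h
  have e : ∀ x y, |-Real.log (weight p q x) - -Real.log (weight p q y)|
      = |Real.log (weight p q x) - Real.log (weight p q y)| := fun x y => by
    rw [← abs_neg]
    ring_nf
  simp_rw [e] at h
  exact h

/-- **Target-side standard-deviation form**: `acc(p, q) ≥ exp(−D(p‖q) − σ_p(log w)/√3)`,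
`σ_p(log w)² = E_p[(log w)²] − (E_p log w)²` (Glasser under `p`). [ours] -/
theorem exp_neg_klFin_fwd_sub_sqrt_third_var_le_accRate {p q : X → ℝ} (hp : ∀ x, 0 < p x)
    (hq : ∀ x, 0 < q x) (hp1 : ∑ x, p x = 1) (hq1 : ∑ x, q x = 1) :
    Real.exp (-klFin p q - Real.sqrt ((∑ x, p x * Real.log (weight p q x) ^ 2
        - (∑ x, p x * Real.log (weight p q x)) ^ 2) / 3))
      ≤ accRate p q := by
  refine le_trans (Real.exp_le_exp.mpr ?_)
    (exp_neg_klFin_fwd_sub_half_mad_le_accRate hp hq hp1 hq1)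
  have h := half_qq_abs_sub_le_sqrt_third_var (fun x => Real.log (weight p q x))
    (fun x => (hp x).le) hp1
  linarith

/-- **Both floors at once**: `acc(p, q) ≥ exp(−min(D(q‖p) + Γ_q/2, D(p‖q) + Γ_p/2))` with
`Γ_r = E_{r⊗r}|log w − log w′|` the Gini mean difference of the log-weight under `r`. [ours] -/
theorem exp_neg_min_jensen_le_accRate {p q : X → ℝ} (hp : ∀ x, 0 < p x) (hq : ∀ x, 0 < q x)
    (hp1 : ∑ x, p x = 1) (hq1 : ∑ x, q x = 1) :
    Real.exp (-min
        (klFin q p + (∑ x, ∑ y, q x * q y * |Real.log (weight p q x) - Real.log (weight p q y)|) / 2)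
        (klFin p q + (∑ x, ∑ y, p x * p y * |Real.log (weight p q x) - Real.log (weight p q y)|) / 2))
      ≤ accRate p q := by
  rcases min_choice
      (klFin q p + (∑ x, ∑ y, q x * q y * |Real.log (weight p q x) - Real.log (weight p q y)|) / 2)
      (klFin p q + (∑ x, ∑ y, p x * p y * |Real.log (weight p q x) - Real.log (weight p q y)|) / 2)
    with h | h <;> rw [h, neg_add']
  · exact exp_neg_klFin_sub_half_mad_le_accRate hp hq hp1 hq1
  · exact exp_neg_klFin_fwd_sub_half_mad_le_accRate hp hq hp1 hq1

end Summit.Ventures.LatticeQCDFlow.Theory2
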